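import Literature.Computability.AlgebraicComplexity.BorderRankMatMulThreeKernel
import Literature.Computability.AlgebraicComplexity.BorderRankMatMulThreeEnumData
import HarnessLib

/-!
# Borel-fixed `(110)`-candidates of `⟨3,3,3⟩`: kernel run of the test procedure, part 7

Topic `Literature/Computability/AlgebraicComplexity`. The kernel evaluates the verdict
`MatMul3.Ker.verdictH` of `BorderRankMatMulThreeKernel.lean` (at most one free block, and for every
variant of the free diagonal the hinted test `(210)`/`(120)` has certified dimension `≤ 15`) on the
killed profiles `MatMul3.killedProfs[220 .. 232)` of `BorderRankMatMulThreeEnumData.lean`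
(`decide +kernel`, in sub-ranges sized to the default heartbeat budget; the twelve parts are
assembled in `BorderRankMatMulThreeVerdictRun.lean`). Soundness of the verdict is
`MatMul3.IsAdmissible.test_le_of_verdictH` (`BorderRankMatMulThreeVerdict.lean`).

## References

* A. Conner, A. Harper, J. M. Landsberg, *New lower bounds for matrix multiplication and `det₃`*,
  Forum Math. Pi 11 (2023) e17, arXiv:1911.07981 — §6. [ConnerHarperLandsberg2023]
-/

namespace Literature.Computability.AlgebraicComplexity

namespace BorderApolarity

namespace MatMul3

/-- Kernel run on the killed profiles of index `220 ≤ i < 224`. [cite: ConnerHarperLandsberg2023, §6] -/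
theorem verdictRun7_1 : ∀ i : ℕ, 220 ≤ i → i < 224 →
    Ker.verdictH (killedProfs.getD i ([], [])).1 (killedProfs.getD i ([], [])).2 = true := by
  decide +kernel

/-- Kernel run on the killed profiles of index `224 ≤ i < 226`. [cite: ConnerHarperLandsberg2023, §6] -/
theorem verdictRun7_2 : ∀ i : ℕ, 224 ≤ i → i < 226 →
    Ker.verdictH (killedProfs.getD i ([], [])).1 (killedProfs.getD i ([], [])).2 = true := by
  decide +kernel

/-- Kernel run on the killed profiles of index `226 ≤ i < 227`. [cite: ConnerHarperLandsberg2023, §6] -/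
theorem verdictRun7_3 : ∀ i : ℕ, 226 ≤ i → i < 227 →
    Ker.verdictH (killedProfs.getD i ([], [])).1 (killedProfs.getD i ([], [])).2 = true := by
  decide +kernel

/-- Kernel run on the killed profiles of index `227 ≤ i < 228`. [cite: ConnerHarperLandsberg2023, §6] -/
theorem verdictRun7_4 : ∀ i : ℕ, 227 ≤ i → i < 228 →
    Ker.verdictH (killedProfs.getD i ([], [])).1 (killedProfs.getD i ([], [])).2 = true := by
  decide +kernel

/-- Kernel run on the killed profiles of index `228 ≤ i < 229`. [cite: ConnerHarperLandsberg2023, §6] -/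
theorem verdictRun7_5 : ∀ i : ℕ, 228 ≤ i → i < 229 →
    Ker.verdictH (killedProfs.getD i ([], [])).1 (killedProfs.getD i ([], [])).2 = true := by
  decide +kernel

/-- Kernel run on the killed profiles of index `229 ≤ i < 230`. [cite: ConnerHarperLandsberg2023, §6] -/
theorem verdictRun7_6 : ∀ i : ℕ, 229 ≤ i → i < 230 →
    Ker.verdictH (killedProfs.getD i ([], [])).1 (killedProfs.getD i ([], [])).2 = true := by
  decide +kernel

/-- Kernel run on the killed profiles of index `230 ≤ i < 231`. [cite: ConnerHarperLandsberg2023, §6] -/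
theorem verdictRun7_7 : ∀ i : ℕ, 230 ≤ i → i < 231 →
    Ker.verdictH (killedProfs.getD i ([], [])).1 (killedProfs.getD i ([], [])).2 = true := by
  decide +kernel

/-- Kernel run on the killed profiles of index `231 ≤ i < 232`. [cite: ConnerHarperLandsberg2023, §6] -/
theorem verdictRun7_8 : ∀ i : ℕ, 231 ≤ i → i < 232 →
    Ker.verdictH (killedProfs.getD i ([], [])).1 (killedProfs.getD i ([], [])).2 = true := by
  decide +kernel

/-- **Kernel run, part 7**: the verdict holds for the killed profiles of index `220 ≤ i < 232`.
[cite: ConnerHarperLandsberg2023, §6] -/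
theorem verdictRun7 (i : ℕ) (h₁ : 220 ≤ i) (h₂ : i < 232) :
    Ker.verdictH (killedProfs.getD i ([], [])).1 (killedProfs.getD i ([], [])).2 = true := by
  by_cases g1 : i < 224
  · exact verdictRun7_1 i (by omega) g1
  by_cases g2 : i < 226
  · exact verdictRun7_2 i (by omega) g2
  by_cases g3 : i < 227
  · exact verdictRun7_3 i (by omega) g3
  by_cases g4 : i < 228
  · exact verdictRun7_4 i (by omega) g4
  by_cases g5 : i < 229
  · exact verdictRun7_5 i (by omega) g5
  by_cases g6 : i < 230
  · exact verdictRun7_6 i (by omega) g6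
  by_cases g7 : i < 231
  · exact verdictRun7_7 i (by omega) g7
  exact verdictRun7_8 i (by omega) h₂

end MatMul3

end BorderApolarity

end Literature.Computability.AlgebraicComplexity
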